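import Summits.AtomisticToContinuum.Crystallization.Theorems.PalmUnimodularRigidityLayeredLawsSelectHcpCertificateDefs
import Summits.AtomisticToContinuum.Crystallization.Theorems.PalmUnimodularRigidityLayeredLawsSelectHcpCharts
import Summits.AtomisticToContinuum.Crystallization.Theorems.PalmUnimodularRigidityLayeredLawsSelectHcpRootedChartUnique
import Summits.AtomisticToContinuum.Crystallization.Theorems.PalmUnimodularRigidityLayeredLawsSelectHcpAtomsCountRestrict

/-!
# Crux `LayeredLawsSelectHcp` (stmt-AtomisticToContinuum-9226), line `mtp-prestress-split-ergodic-frame`: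
# an hcp-charted configuration has exactly twelve rooted charts

Registered sub-goal `tube_rootedCharts_ncard` of the crux item (block R3-B' of the certificate architecture): for an
hcp-charted `S ∋ 0` with good shells the set `rootedCharts (count|S)` of rooted labelled charts (`CertificateDefs`:
`X : ℤ³ → S`, `X 0 = 0`, onto, ideal unit struts ↔ bonds) is finite with EXACTLY twelve elements — the normalisation
`1/12` of `chartAvg`.  Pure combinatorics of the contact graph of the ideal hcp:

* `exists_hcpIndexAut` — the point group `D₃ₕ` of an hcp site in INDEX form: the twelve self-maps
  `A t = F^a ∘ M^b ∘ R^c` of `ℤ³` (`(a, b, c) = (t/6, t/3 mod 2, t mod 3)`) generated by the `3`-fold rotation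
  `R (k,i,j) = (k, −i−j−L, i)` about the vertical axis through the root (`L = k mod 2` the letter of the layer), the
  vertical mirror `M (k,i,j) = (k,j,i)` swapping the two in-layer axes and the horizontal mirror `F (k,i,j) = (−k,i,j)`
  (letters of `alternatingHagg` depend on the parity of the layer only; the three maps are those of
  `ZeroStressSymmetry`, written as plain lambdas — no new definitions).  Each `A t` preserves the integer metric
  `siteQ` of `LocalCongruenceSites` (by `ring`), hence the unit struts, fixes `0` and is onto; the twelve are pairwise
  different already at the labels `(0,1,0)`, `(1,0,0)`; and — the kernel search `autCands` of `LocalCongruenceStar`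
  re-read by `decide` — every automorphism of the contact graph of the twelve-point star is the restriction of one of
  them;
* so `X₀ ∘ A t`, `t : Fin 12`, are twelve distinct rooted charts for any rooted chart `X₀` (one exists,
  `tube_exists_rootedChart`; charts are injective, `RootedChartUnique.chart_injective`);
* at most twelve: for a rooted chart `X` the index map `σ = X₀⁻¹ ∘ X` preserves the unit struts in both directions and
  fixes `0`, so on the star it is an injective automorphism of the contact graph (`exists_autCands_eqOn_star`), i.e. the
  restriction of some `A t`; then `X` and `X₀ ∘ A t` are rooted charts agreeing on the star, hence equal
  (`tube_rootedChart_unique`, landed).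

All `[folklore]`.
-/

noncomputable section

namespace Summit.AtomisticToContinuum.Crystallization.Theorems.PalmUnimodularRigidity.LayeredLawsSelectHcp

open MeasureTheory Set
open Literature.MathematicalPhysics.StatisticalMechanics Literature.Geometry.DiscreteGeometry
open Summit.AtomisticToContinuum.Crystallization.Theorems.LayeredLawsSelectHcp.Negative.DiracLaws (GoodShell)

/-! ## The twelve rooted automorphisms of the ideal hcp index set -/

/-- Iterates of a `siteQ`-preserving index map preserve the integer metric pair `siteQ`. [folklore] -/
theorem siteQ_iterate {f : ℤ × ℤ × ℤ → ℤ × ℤ × ℤ} (hf : ∀ u w, siteQ (f u) (f w) = siteQ u w) (n : ℕ)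
    (u w : ℤ × ℤ × ℤ) : siteQ (f^[n] u) (f^[n] w) = siteQ u w := by
  induction n generalizing u w with
  | zero => rfl
  | succ n ih => rw [Function.iterate_succ_apply, Function.iterate_succ_apply, ih, hf]

/-- The powers of the index rotation `(k, i, j) ↦ (k, −i − j − L, i)`, `L = k mod 2` (on the integer site coordinates
`siteInt`: `(x, y) ↦ (−(x + y)/2, (3x − y)/2)`), preserve `siteQ`. [folklore] -/
theorem siteQ_rot_iterate (n : ℕ) (u w : ℤ × ℤ × ℤ) :
    siteQ ((fun v : ℤ × ℤ × ℤ => (v.1, -v.2.1 - v.2.2 - v.1 % 2, v.2.1))^[n] u)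
      ((fun v : ℤ × ℤ × ℤ => (v.1, -v.2.1 - v.2.2 - v.1 % 2, v.2.1))^[n] w) = siteQ u w := by
  refine siteQ_iterate (fun u w => ?_) n u w
  refine Prod.ext ?_ ?_ <;> simp only [siteQ, siteInt]
  ring

/-- The powers of the index mirror `(k, i, j) ↦ (k, j, i)` preserve `siteQ`. [folklore] -/
theorem siteQ_mir_iterate (n : ℕ) (u w : ℤ × ℤ × ℤ) :
    siteQ ((fun v : ℤ × ℤ × ℤ => (v.1, v.2.2, v.2.1))^[n] u) ((fun v : ℤ × ℤ × ℤ => (v.1, v.2.2, v.2.1))^[n] w) =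
      siteQ u w := by
  refine siteQ_iterate (fun u w => ?_) n u w
  refine Prod.ext ?_ ?_ <;> simp only [siteQ, siteInt]
  ring

/-- The powers of the index mirror `(k, i, j) ↦ (−k, i, j)` preserve `siteQ` (the letter of layer `−k` is that of
layer `k`). [folklore] -/
theorem siteQ_flip_iterate (n : ℕ) (u w : ℤ × ℤ × ℤ) :
    siteQ ((fun v : ℤ × ℤ × ℤ => (-v.1, v.2.1, v.2.2))^[n] u) ((fun v : ℤ × ℤ × ℤ => (-v.1, v.2.1, v.2.2))^[n] w) =
      siteQ u w := by
  refine siteQ_iterate (fun u w => ?_) n u w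
  have hu : (-u.1) % 2 = u.1 % 2 := by omega
  have hw : (-w.1) % 2 = w.1 % 2 := by omega
  refine Prod.ext ?_ ?_ <;> simp only [siteQ, siteInt, hu, hw]
  ring

/-- The index rotation is onto (its cube is the identity). [folklore] -/
theorem rot_surjective : Function.Surjective fun v : ℤ × ℤ × ℤ => (v.1, -v.2.1 - v.2.2 - v.1 % 2, v.2.1) :=
  fun v => ⟨(v.1, v.2.2, -v.2.1 - v.2.2 - v.1 % 2), by
    refine Prod.ext rfl (Prod.ext ?_ rfl)
    dsimp only
    ring⟩

/-- The two index mirrors are onto (involutions). [folklore] -/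
theorem mir_flip_surjective : (Function.Surjective fun v : ℤ × ℤ × ℤ => (v.1, v.2.2, v.2.1)) ∧
    Function.Surjective fun v : ℤ × ℤ × ℤ => (-v.1, v.2.1, v.2.2) :=
  ⟨fun v => ⟨(v.1, v.2.2, v.2.1), rfl⟩, fun v => ⟨(-v.1, v.2.1, v.2.2), Prod.ext (neg_neg _) rfl⟩⟩

/-- **The twelve rooted automorphisms of the ideal hcp index set** (the point group `D₃ₕ` of an hcp site in index
form): twelve self-maps `A t` of `ℤ³` fixing `0`, onto, preserving the integer metric `siteQ` (hence every relaxed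
hcp metric), pairwise different at the labels `(0,1,0)`, `(1,0,0)`, and such that every complete candidate of the
automorphism search `autCands` of the contact graph of the star is the restriction of one of them (Boolean form, by
`decide`).  Witness: `A t = F^a ∘ M^b ∘ R^c`, `(a, b, c) = (t/6, t/3 mod 2, t mod 3)`, with the rotation `R` and the
mirrors `M`, `F` above. [folklore] -/
theorem exists_hcpIndexAut : ∃ A : Fin 12 → ℤ × ℤ × ℤ → ℤ × ℤ × ℤ,
    (∀ t, A t 0 = 0) ∧ (∀ t, Function.Surjective (A t)) ∧ (∀ t u w, siteQ (A t u) (A t w) = siteQ u w) ∧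
    (∀ s t, A s (0, 1, 0) = A t (0, 1, 0) → A s (1, 0, 0) = A t (1, 0, 0) → s = t) ∧
    ((autCands 12).all fun g => (List.finRange 12).any fun t => allLab.all fun m =>
      decide (starLab (g m) = A t (starLab m))) = true := by
  refine ⟨fun t v => (fun v : ℤ × ℤ × ℤ => (-v.1, v.2.1, v.2.2))^[t.val / 6]
      ((fun v : ℤ × ℤ × ℤ => (v.1, v.2.2, v.2.1))^[t.val / 3 % 2]
        ((fun v : ℤ × ℤ × ℤ => (v.1, -v.2.1 - v.2.2 - v.1 % 2, v.2.1))^[t.val % 3] v)), ?_, ?_, ?_, ?_, ?_⟩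
  · decide
  · intro t
    exact ((mir_flip_surjective.2.iterate _).comp (mir_flip_surjective.1.iterate _)).comp (rot_surjective.iterate _)
  · intro t u w
    exact (siteQ_flip_iterate _ _ _).trans ((siteQ_mir_iterate _ _ _).trans (siteQ_rot_iterate _ _ _))
  · decide
  · decide +kernel

/-! ## A strut-preserving index map fixing the root is an automorphism of the star -/

/-- The star labels are the labels touching the root. [folklore] -/
theorem mem_hcpStarIdx_iff_dist (δ : ℤ × ℤ × ℤ) :
    δ ∈ hcpStarIdx ↔ dist (hcpSite 1 (Real.sqrt (2 / 3)) 0) (hcpSite 1 (Real.sqrt (2 / 3)) δ) = 1 := by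
  rw [dist_ideal_eq_one_iff_nbr]
  refine ⟨fun h => ⟨δ, h, (RootedChartUnique.nbr_zero δ).symm⟩, ?_⟩
  rintro ⟨ε, hε, rfl⟩
  rwa [RootedChartUnique.nbr_zero]

/-- **A self-map of `ℤ³` preserving the ideal unit struts in both directions and fixing the root restricts on the twelve
star labels to an automorphism of the contact graph of the star**, i.e. to a complete candidate of the search
`autCands` (it is injective, `RootedChartUnique.ideal_eq_of_adj_iff`, maps the star into itself, and preserves touching;
`autCands_complete`). [folklore] -/
theorem exists_autCands_eqOn_star {σ : ℤ × ℤ × ℤ → ℤ × ℤ × ℤ}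
    (hσ : ∀ u w, dist (hcpSite 1 (Real.sqrt (2 / 3)) (σ u)) (hcpSite 1 (Real.sqrt (2 / 3)) (σ w)) = 1 ↔
      dist (hcpSite 1 (Real.sqrt (2 / 3)) u) (hcpSite 1 (Real.sqrt (2 / 3)) w) = 1) (h0 : σ 0 = 0) :
    ∃ g ∈ autCands 12, ∀ m : Fin 12, σ (starLab m) = starLab (g m) := by
  have hσinj : Function.Injective σ := fun u u' huu' =>
    RootedChartUnique.ideal_eq_of_adj_iff fun z => by rw [← hσ u z, ← hσ u' z, huu']
  have hmaps : ∀ δ ∈ hcpStarIdx, σ δ ∈ hcpStarIdx := fun δ hδ => by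
    rw [mem_hcpStarIdx_iff_dist] at hδ ⊢
    rw [← h0, hσ]
    exact hδ
  have hex : ∀ m : Fin 12, ∃ n : Fin 12, starLab n = σ (starLab m) := fun m =>
    exists_starLab_eq (hmaps _ (starLab_mem m))
  choose f hf using hex
  have hfinj : Function.Injective f := fun m m' hmm' =>
    starLab_injective (hσinj (by rw [← hf m, ← hf m', hmm']))
  have hfadj : ∀ m n, starAdjT (f m) (f n) = starAdjT m n := fun m n => by
    have key := hσ (starLab m) (starLab n)
    rw [← hf m, ← hf n, dist_ideal_eq_one_iff, dist_ideal_eq_one_iff] at key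
    rw [starAdjT_spec, starAdjT_spec, decide_eq_decide]
    exact key
  obtain ⟨g, hg, hgf⟩ := autCands_complete hfinj hfadj 12
  exact ⟨g, hg, fun m => by rw [hgf m m.2, hf m]⟩

/-! ## The count -/

/-- **Registered sub-goal `tube_rootedCharts_ncard` — an hcp-charted configuration has exactly twelve rooted charts.**
For an hcp-charted `S ∋ 0` with good shells, `rootedCharts (count|S)` is finite of cardinality `12`: it is the injective
image `t ↦ X₀ ∘ A t` of `Fin 12` for any one rooted chart `X₀` (`tube_exists_rootedChart`) and the twelve index
automorphisms `A t` (`exists_hcpIndexAut`); every rooted chart agrees with one of these on the star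
(`exists_autCands_eqOn_star`), hence equals it (`tube_rootedChart_unique`). [folklore] -/
theorem tube_rootedCharts_ncard : ∀ S : Set (EuclideanSpace ℝ (Fin 3)), (0 : EuclideanSpace ℝ (Fin 3)) ∈ S → (∀ x ∈ S, GoodShell S x) → HcpCharted S → (rootedCharts ((MeasureTheory.Measure.count : MeasureTheory.Measure (EuclideanSpace ℝ (Fin 3))).restrict S)).Finite ∧ (rootedCharts ((MeasureTheory.Measure.count : MeasureTheory.Measure (EuclideanSpace ℝ (Fin 3))).restrict S)).ncard = 12 := by
  intro S h0 hgood hchart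
  obtain ⟨X₀, hX0, hXS, hSX, hXc⟩ := tube_exists_rootedChart S h0 hchart
  have hinj : Function.Injective X₀ := RootedChartUnique.chart_injective hXc
  obtain ⟨A, hA0, hAsurj, hAQ, hAne, hAB⟩ := exists_hcpIndexAut
  have hAaut : ∀ g ∈ autCands 12, ∃ t, ∀ m : Fin 12, starLab (g m) = A t (starLab m) := fun g hg => by
    simp only [List.all_eq_true, List.any_eq_true, decide_eq_true_eq] at hAB
    obtain ⟨t, -, ht⟩ := hAB g hg
    exact ⟨t, fun m => ht m (mem_allLab m)⟩
  have hAadj : ∀ t u w,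
      (dist (hcpSite 1 (Real.sqrt (2 / 3)) (A t u)) (hcpSite 1 (Real.sqrt (2 / 3)) (A t w)) = 1 ↔
        dist (hcpSite 1 (Real.sqrt (2 / 3)) u) (hcpSite 1 (Real.sqrt (2 / 3)) w) = 1) := fun t u w => by
    rw [dist_ideal_eq_one_iff, dist_ideal_eq_one_iff, hAQ]
  obtain ⟨F, hF⟩ : ∃ F : Fin 12 → ℤ × ℤ × ℤ → EuclideanSpace ℝ (Fin 3), ∀ t u, F t u = X₀ (A t u) :=
    ⟨fun t u => X₀ (A t u), fun _ _ => rfl⟩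
  -- the twelve charts `X₀ ∘ A t`
  have hFmem : ∀ t, IsRootedChart S (F t) := fun t =>
    ⟨by rw [hF, hA0, hX0], fun u => by rw [hF]; exact hXS _, fun y hy => by
      obtain ⟨u, rfl⟩ := hSX y hy
      obtain ⟨u', rfl⟩ := hAsurj t u
      exact ⟨u', hF t u'⟩,
     fun u w => by rw [hF, hF, ← hAadj t]; exact hXc _ _⟩
  have hFinj : Function.Injective F := fun s t hst => by
    have h1 := congrFun hst (0, 1, 0)
    have h2 := congrFun hst (1, 0, 0)
    rw [hF, hF] at h1 h2
    exact hAne s t (hinj h1) (hinj h2)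
  -- every rooted chart is one of them
  have hall : ∀ X, IsRootedChart S X → ∃ t, F t = X := fun X hX => by
    obtain ⟨hX0', hXS', -, hXc'⟩ := id hX
    choose σ hσ using fun u => hSX (X u) (hXS' u)
    have hσadj : ∀ u w, dist (hcpSite 1 (Real.sqrt (2 / 3)) (σ u)) (hcpSite 1 (Real.sqrt (2 / 3)) (σ w)) = 1 ↔
        dist (hcpSite 1 (Real.sqrt (2 / 3)) u) (hcpSite 1 (Real.sqrt (2 / 3)) w) = 1 := fun u w => by
      rw [hXc, hσ, hσ, ← hXc']
    have hσ0 : σ 0 = 0 := hinj (by rw [hσ, hX0', hX0])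
    obtain ⟨g, hg, hσg⟩ := exists_autCands_eqOn_star hσadj hσ0
    obtain ⟨t, ht⟩ := hAaut g hg
    refine ⟨t, (tube_rootedChart_unique S X (F t) hgood hX (hFmem t) fun v hv => ?_).symm⟩
    obtain ⟨m, rfl⟩ := exists_starLab_eq hv
    rw [hF, ← ht m, ← hσg m, hσ]
  have hset : rootedCharts ((Measure.count : Measure (EuclideanSpace ℝ (Fin 3))).restrict S) = Set.range F := by
    ext X
    rw [mem_rootedCharts_count_restrict, Set.mem_range]
    exact ⟨hall X, fun ⟨t, ht⟩ => ht ▸ hFmem t⟩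
  rw [hset]
  exact ⟨Set.finite_range F, by rw [Set.ncard_range_of_injective hFinj, Nat.card_eq_fintype_card, Fintype.card_fin]⟩

end Summit.AtomisticToContinuum.Crystallization.Theorems.PalmUnimodularRigidity.LayeredLawsSelectHcp

end
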